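/-
Copyright (c) 2026 the pub-hodgecm-mathlib formalisation cell (harness21).  Prover seat hodgecm-mathlib-LH4-p06 (g3): Track A «(D-RAM) FOUR-FRAME» squad of crux H413, unit
U2H (ii-H), ROW (2) leaf (ρ2b′-τ) (letters LH4-p06 (g3) ∕ LH4-p12 (g2) 2026-09-04 00:34–00:40Z: «(ρ2b′-τ) = the scalar, p06; (ρ2b′-X) = the census, p12»), 2026-09-04.
-/
import Literature.NumberTheory.Rogawski1990.FinExplicitTransferFactorDeepTauAnyPlacePairs   -- ★ `exists_nhds_one_forall_finExplicitDelta_eq_hilbertSymbol_mul_anyPlace`, `valued_eval_eq_valued_toPlace_pow_toNat_of_toPlace_eq_of_valued_le_two_mul`; brings ★ DeepTauAnyPlace (`exists_units_toPlace_eq_symmDisc_of_deep_anyPlace`, `exists_valued_two_eq_valued_toPlace_heckeUniformizer_pow`)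
import Literature.NumberTheory.Rogawski1990.FinExplicitTransferFactorRamifiedLiterals       -- ★ `finTau_mul_finWeylRatio_eq_of_finExplicitDelta_eq` (§1, place-free: divide `Δ‴ = C·κ` by `κ = ±1`)
import Literature.NumberTheory.Rogawski1990.FinExplicitTransferFactorNondegenerate          -- ★ `isUnit_eval_finCharpolyTwo_of_isLocalGRegular` (`χ_g(u) ≠ 0` at a `G`-regular `γ_H`)
import HarnessLib

/-!
# The depth token, the symmetrised discriminant and the scalar `τ_v·D_{G∕H,v} = (β, θ)_v · q_v^{−m}` near `1 ∈ H_v`, POPULATION-FREE, at ANY non-split place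
# (`p = 2` allowed) — the `|2|`-free twin of ★ `DepthZeroKappaTransferRamifiedTokensScalar` (Rogawski 1990 §4.9 p. 55, Lemma 4.9.3 p. 56; Labesse–Langlands 1979 §2)

Topic `NumberTheory/Rogawski1990`; namespace `Literature.NumberTheory.Rogawski1990`.  THEOREMS ONLY (no definition, no instance, no notation, no named fact, no `sorry`, default
heartbeats); kernel lane `--supports stmt-HodgeConjecture-24833` (count-neutral).  Cell `pub/hodgecm-mathlib` (D-0151), crux H413; Track A «(D-RAM) FOUR-FRAME», unit U2H ROW (2):
this is the leaf **(ρ2b′-τ)** of the κ-gated child (ρ2b′) `stub_U2H_fixedPointLaw_typeTwo_unit0` of `Cruxes/H413/Lines/F0_P3c_DyRamFourFrame_U2H_HSide.lean` — the SCALAR in front of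
the signed fixed-point counts, evaluated near `1` at a WILD ramified place, so that the census leaf (ρ2b′-X) can be typed μ-FREE in pure counts (LH4-p12 (g2)).

WHAT IS PROVED (★ `DepthZeroKappaTransferRamifiedTokensScalar`'s three theorems with the binder `h2 : IsUnit (2 : 𝒪_w)` DELETED; nothing else in the statements moves except the
residue-cardinal spelling `Nat.card (𝓞_{L⁺} ⧸ v)` of the any-place organ ★ `exists_nhds_one_forall_finExplicitDelta_eq_hilbertSymbol_mul_anyPlace`, bridged to `Ideal.absNorm v` by ★
`natCard_quot_eq_absNorm_cast` when wanted):
* §1 `tokens_anyPlace_of_isLocalGRegular` — there is `V ∈ 𝓝 (1 : H_v)` such that every `G`-regular `γ_H ∈ V` has a DEPTH TOKEN `m` (`|χ_g(u)_w| = |ι_w ϖ_v|^m`) and a SYMMETRISED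
  DISCRIMINANT `β ∈ (L⁺_v)ˣ` (`ι_w β = −χ_g(u)_w (u_w² + det g_w)∕(2u_w² det g_w)`).  `V` = the `|2|·|ι_w ϖ_v|`-deep tube (`|u_w − 1|, |det g_w − 1| ≤ |ι_w ϖ_v|^{1+a}`, `|2|_w = |ι_w ϖ_v|^a`
  by ★ `exists_valued_two_eq_valued_toPlace_heckeUniformizer_pow`) ∩ `{|χ_g(u)_w| < 1}`; `β` by ★ `exists_units_toPlace_eq_symmDisc_of_deep_anyPlace` (`M₀ = 1`), `m := ord_v β` by ★
  `valued_eval_eq_valued_toPlace_pow_toNat_of_toPlace_eq_of_valued_le_two_mul`; `χ_g(u)_w ≠ 0` by `G`-regularity (★ `isUnit_eval_finCharpolyTwo_of_isLocalGRegular`).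
* §2 `exists_nhds_one_forall_finTau_mul_finWeylRatio_eq_anyPlace` — under print's guard `μ|_{𝕀_{L⁺}} = ω` there is `V ∈ 𝓝 1` (depending on `μ`) with, for every `γ_H ∈ V`, all tokens
  `m, β` and every match `t` of κ-sign `±1`: **`τ_v(γ_H, μ)·D_{G∕H,v}(γ_H) = (β, θ)_v · q_v^{−m}`**, `q_v = #(𝓞_{L⁺} ⧸ v)` (★ any-place pairs organ: `Δ‴ = (β, θ)_v q_v^{−m} κ`; ★ divide by `κ`).
* §3 `exists_nhds_one_forall_tokens_finTau_mul_finWeylRatio_eq_anyPlace` — §1 ∩ §2 on one neighbourhood.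

HONEST LABEL: HC_CM is proved only modulo the 7 printed citations (2 remaining named inputs: hLiu418 = stmt-HodgeConjecture-24832, h413 = stmt-HodgeConjecture-24833) until rung 0
closes; unconditional local algebra over ★ organs, count-neutral.

## References
* [Rogawski1990] J. D. Rogawski, *Automorphic Representations of Unitary Groups in Three Variables*, Ann. of Math. Stud. 123 (1990): §4.9 p. 55, Lemma 4.9.3 p. 56; §4.3 (4.3.1)
  p. 43; Prop. 8.1.3 p. 116.
* [LabesseLanglands1979] J.-P. Labesse, R. P. Langlands, *L-indistinguishability for SL(2)*, Canad. J. Math. 31 (1979), §2 (2.1)–(2.2).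
-/

set_option autoImplicit false

noncomputable section

open NumberField IsDedekindDomain Matrix Filter Topology Polynomial
open scoped MatrixGroups ValuativeRel

namespace Literature.NumberTheory.Rogawski1990

open Literature.NumberTheory.Automorphic Literature.NumberTheory.Automorphic.UnitaryGroup
open Literature.NumberTheory.GaloisRepresentations Literature.NumberTheory.NumberFields Literature.NumberTheory.QuadraticForms

variable (L : Type) [Field L] [NumberField L] [IsCMField L] (v : HeightOneSpectrum (𝓞 ↥(maximalRealSubfield L)))
  (w : PlacesOver L v) (hw : IsCMField.complexConj L • w.1 = w.1)

/-! ## §1 The depth token and the symmetrised discriminant near `1`, for every `G`-regular `γ_H`, at any place -/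

include hw in
/-- **TOKENS, POPULATION-FREE, ANY RESIDUE CHARACTERISTIC.**  At a non-split place `w ∣ v` (dyadic allowed) there is `V ∈ 𝓝 (1 : H_v)` such that every `G`-regular `γ_H ∈ V` has a
depth token `m` (`|χ_g(u)_w| = |ι_w ϖ_v|^m`) and a symmetrised discriminant `β ∈ (L⁺_v)ˣ` (`ι_w β = −χ_g(u)_w (u_w² + det g_w)∕(2u_w² det g_w)`).  `V` = the `|2|·|ι_w ϖ_v|`-deep
tube ∩ `{|χ_g(u)_w| < 1}` (★ `eventually_nhds_one_valued_sub_one_le`, ★ `eventually_nhds_one_valued_eval_lt_one`); `β` by ★ `exists_units_toPlace_eq_symmDisc_of_deep_anyPlace`, `m = ord_v β` by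
★ `valued_eval_eq_valued_toPlace_pow_toNat_of_toPlace_eq_of_valued_le_two_mul`.  The `|2|`-free twin of ★ `tokens_ram_of_isLocalGRegular`. [cite: Rogawski1990, §4.9 p. 55, Lemma 4.9.3 p. 56]
[cite: LabesseLanglands1979, §2 (2.1)] -/
theorem tokens_anyPlace_of_isLocalGRegular :
    ∃ V ∈ 𝓝 (1 : ((cmDatum L 2 (Matrix.of fun i j : Fin 2 => if i.val + j.val + 1 = 2 then (1 : L) else 0)).Local v ×
        (cmDatum L 1 (Matrix.of fun i j : Fin 1 => if i.val + j.val + 1 = 1 then (1 : L) else 0)).Local v)),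
      ∀ γH ∈ V, IsLocalGRegular L v γH →
        (∃ m : ℕ, Valued.v (((finCharpolyTwo L v γH).eval (finGammaTwo L v γH)) w) =
          Valued.v ((toPlace v w (HeckeCharacter.uniformizer ↥(maximalRealSubfield L) v : v.adicCompletion ↥(maximalRealSubfield L))) ^ m)) ∧
        ∃ β : (v.adicCompletion ↥(maximalRealSubfield L))ˣ, toPlace v w (β : v.adicCompletion ↥(maximalRealSubfield L)) =
            -(((finCharpolyTwo L v γH).eval (finGammaTwo L v γH)) w *
                (finGammaTwo L v γH w ^ 2 +
                  ((γH.1.val.val : Matrix (Fin 2) (Fin 2) (UnitaryGroup.LocalRing L v)).map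
                    (Pi.evalRingHom (fun w' : UnitaryGroup.PlacesOver L v => w'.1.adicCompletion L) w)).det)) /
              (2 * finGammaTwo L v γH w ^ 2 *
                ((γH.1.val.val : Matrix (Fin 2) (Fin 2) (UnitaryGroup.LocalRing L v)).map
                    (Pi.evalRingHom (fun w' : UnitaryGroup.PlacesOver L v => w'.1.adicCompletion L) w)).det) := by
  obtain ⟨a, ha⟩ := exists_valued_two_eq_valued_toPlace_heckeUniformizer_pow L v w
  have hϖ0 : (toPlace v w (HeckeCharacter.uniformizer ↥(maximalRealSubfield L) v : v.adicCompletion ↥(maximalRealSubfield L))) ^ (1 + a) ≠ 0 :=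
    pow_ne_zero _ (toPlace_heckeUniformizer_ne_zero L v w)
  have h1a : Valued.v ((toPlace v w (HeckeCharacter.uniformizer ↥(maximalRealSubfield L) v : v.adicCompletion ↥(maximalRealSubfield L))) ^ (1 + a)) =
      Valued.v (2 : w.1.adicCompletion L) *
        Valued.v ((toPlace v w (HeckeCharacter.uniformizer ↥(maximalRealSubfield L) v : v.adicCompletion ↥(maximalRealSubfield L))) ^ 1) := by
    rw [pow_add, Valuation.map_mul, ← ha, mul_comm]
  refine (Filter.Eventually.exists_mem ?_)
  filter_upwards [eventually_nhds_one_valued_sub_one_le L v w hϖ0, eventually_nhds_one_valued_eval_lt_one L v w] with γH hγ hχ hreg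
  have hunit : IsUnit ((finCharpolyTwo L v γH).eval (finGammaTwo L v γH)) := isUnit_eval_finCharpolyTwo_of_isLocalGRegular L v γH hreg
  have hχ0 : ((finCharpolyTwo L v γH).eval (finGammaTwo L v γH)) w ≠ 0 :=
    (hunit.map (Pi.evalRingHom (fun w' : PlacesOver L v => w'.1.adicCompletion L) w)).ne_zero
  have hud := le_trans hγ.1 (le_of_eq h1a)
  have hdd := le_trans hγ.2 (le_of_eq h1a)
  obtain ⟨β, hβ⟩ := exists_units_toPlace_eq_symmDisc_of_deep_anyPlace L v w hw le_rfl γH hχ0 hud hdd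
  exact ⟨⟨_, valued_eval_eq_valued_toPlace_pow_toNat_of_toPlace_eq_of_valued_le_two_mul L v w le_rfl γH hud hdd hχ.le β hβ⟩, β, hβ⟩

/-! ## §2 The scalar `τ_v · D_{G∕H,v} = (β, θ)_v · q_v^{−m}` near `1` at any place (the neighbourhood depends on `μ`) -/

section Scalar

variable (μ : HeckeCharacter L)
  (hμω : ∀ x : ideleGroup ↥(maximalRealSubfield L), μ (AdeleRing.ideleBaseChange ↥(maximalRealSubfield L) L x) = quadraticHeckeCharCM L x)

include hw hμω in
/-- **THE SCALAR NEAR `1`, ANY RESIDUE CHARACTERISTIC.**  At a non-split place `w ∣ v` (dyadic allowed), under print's guard `μ|_{𝕀_{L⁺}} = ω`: there is `V ∈ 𝓝 (1 : H_v)` (depending on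
`μ`) such that for every `γ_H ∈ V`, every depth token `m` (`|χ_g(u)_w| = |ι_w ϖ_v|^m`), every symmetrised discriminant `β` and every `t ∈ G′_v` matched with `γ_H` with
`κ_v(γ_H, t) = ±1`: **`τ_v(γ_H, μ) · D_{G∕H,v}(γ_H) = (β, θ)_v · #(𝓞_{L⁺} ⧸ v)^{−m}`**.  (★ `exists_nhds_one_forall_finExplicitDelta_eq_hilbertSymbol_mul_anyPlace`: `Δ‴ = (β, θ)_v q_v^{−m} κ`; ★
`finTau_mul_finWeylRatio_eq_of_finExplicitDelta_eq`: divide by `κ ≠ 0`.)  The `|2|`-free twin of ★ `exists_nhds_one_forall_finTau_mul_finWeylRatio_eq`.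
[cite: Rogawski1990, §4.9 p. 55; §4.3 (4.3.1) p. 43; Prop. 8.1.3 p. 116] [cite: LabesseLanglands1979, §2 (2.1)–(2.2)] -/
theorem exists_nhds_one_forall_finTau_mul_finWeylRatio_eq_anyPlace (H' : Matrix (Fin 3) (Fin 3) L) :
    ∃ V ∈ 𝓝 (1 : ((cmDatum L 2 (Matrix.of fun i j : Fin 2 => if i.val + j.val + 1 = 2 then (1 : L) else 0)).Local v ×
        (cmDatum L 1 (Matrix.of fun i j : Fin 1 => if i.val + j.val + 1 = 1 then (1 : L) else 0)).Local v)),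
      ∀ γH ∈ V, ∀ (m : ℕ),
        Valued.v (((finCharpolyTwo L v γH).eval (finGammaTwo L v γH)) w) =
          Valued.v ((toPlace v w (HeckeCharacter.uniformizer ↥(maximalRealSubfield L) v : v.adicCompletion ↥(maximalRealSubfield L))) ^ m) →
        ∀ β : (v.adicCompletion ↥(maximalRealSubfield L))ˣ,
          toPlace v w (β : v.adicCompletion ↥(maximalRealSubfield L)) =
            -(((finCharpolyTwo L v γH).eval (finGammaTwo L v γH)) w *
                (finGammaTwo L v γH w ^ 2 +
                  ((γH.1.val.val : Matrix (Fin 2) (Fin 2) (LocalRing L v)).map (Pi.evalRingHom (fun w' : PlacesOver L v => w'.1.adicCompletion L) w)).det)) /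
              (2 * finGammaTwo L v γH w ^ 2 *
                ((γH.1.val.val : Matrix (Fin 2) (Fin 2) (LocalRing L v)).map (Pi.evalRingHom (fun w' : PlacesOver L v => w'.1.adicCompletion L) w)).det) →
        ∀ t : (cmDatum L 3 H').Local v, IsLocalNormPair L H' v γH t →
          (finKappaAt L v H' γH t = 1 ∨ finKappaAt L v H' γH t = -1) →
          finTau L v γH μ * (finWeylRatio L v γH : ℂ) =
            (hilbertSymbol (v.adicCompletion ↥(maximalRealSubfield L)) (β : v.adicCompletion ↥(maximalRealSubfield L))
                (algebraMap ↥(maximalRealSubfield L) _ ((cmQuadraticGenerator L : 𝓞 ↥(maximalRealSubfield L)) : ↥(maximalRealSubfield L))) : ℂ) *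
              (((Nat.card (𝓞 ↥(maximalRealSubfield L) ⧸ v.asIdeal) : ℂ) ^ m))⁻¹ := by
  obtain ⟨V, hV, hD⟩ := exists_nhds_one_forall_finExplicitDelta_eq_hilbertSymbol_mul_anyPlace L v w hw μ hμω H'
  refine ⟨V, hV, fun γH hγ m hm β hβ t ht hκ => ?_⟩
  rcases hκ with hκ | hκ
  · exact finTau_mul_finWeylRatio_eq_of_finExplicitDelta_eq L v H' μ γH ht (Or.inl rfl) hκ (hD γH hγ m t hm β hβ ht)
  · exact finTau_mul_finWeylRatio_eq_of_finExplicitDelta_eq L v H' μ γH ht (Or.inr rfl) hκ (hD γH hγ m t hm β hβ ht)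

/-! ## §3 Both at once on one neighbourhood -/

include hw hμω in
/-- **TOKENS AND SCALAR ON ONE NEIGHBOURHOOD, ANY RESIDUE CHARACTERISTIC.**  At a non-split place `w ∣ v` (dyadic allowed), under `μ|_{𝕀_{L⁺}} = ω`: there is `V ∈ 𝓝 (1 : H_v)` such
that every `G`-regular `γ_H ∈ V` has a depth token `m` and a symmetrised discriminant `β` for which `τ_v(γ_H, μ)·D_v(γ_H) = (β, θ)_v · #(𝓞_{L⁺} ⧸ v)^{−m}` on every matched `t` with
`κ_v(γ_H, t) = ±1` (§1 ∩ §2) — choose `V` here, hand `m, β` to a μ-FREE count socket ((ρ2b′-X) of the FOUR-FRAME line).  The `|2|`-free twin of ★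
`exists_nhds_one_forall_tokens_finTau_mul_finWeylRatio_eq`. [cite: Rogawski1990, §4.9 p. 55, Lemma 4.9.3 p. 56; §4.3 (4.3.1) p. 43] [cite: LabesseLanglands1979, §2 (2.1)–(2.2)] -/
theorem exists_nhds_one_forall_tokens_finTau_mul_finWeylRatio_eq_anyPlace (H' : Matrix (Fin 3) (Fin 3) L) :
    ∃ V ∈ 𝓝 (1 : ((cmDatum L 2 (Matrix.of fun i j : Fin 2 => if i.val + j.val + 1 = 2 then (1 : L) else 0)).Local v ×
        (cmDatum L 1 (Matrix.of fun i j : Fin 1 => if i.val + j.val + 1 = 1 then (1 : L) else 0)).Local v)),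
      ∀ γH ∈ V, IsLocalGRegular L v γH →
        ∃ (m : ℕ) (β : (v.adicCompletion ↥(maximalRealSubfield L))ˣ),
          Valued.v (((finCharpolyTwo L v γH).eval (finGammaTwo L v γH)) w) =
            Valued.v ((toPlace v w (HeckeCharacter.uniformizer ↥(maximalRealSubfield L) v : v.adicCompletion ↥(maximalRealSubfield L))) ^ m) ∧
          toPlace v w (β : v.adicCompletion ↥(maximalRealSubfield L)) =
            -(((finCharpolyTwo L v γH).eval (finGammaTwo L v γH)) w *
                (finGammaTwo L v γH w ^ 2 +
                  ((γH.1.val.val : Matrix (Fin 2) (Fin 2) (LocalRing L v)).map (Pi.evalRingHom (fun w' : PlacesOver L v => w'.1.adicCompletion L) w)).det)) /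
              (2 * finGammaTwo L v γH w ^ 2 *
                ((γH.1.val.val : Matrix (Fin 2) (Fin 2) (LocalRing L v)).map (Pi.evalRingHom (fun w' : PlacesOver L v => w'.1.adicCompletion L) w)).det) ∧
          ∀ t : (cmDatum L 3 H').Local v, IsLocalNormPair L H' v γH t →
            (finKappaAt L v H' γH t = 1 ∨ finKappaAt L v H' γH t = -1) →
            finTau L v γH μ * (finWeylRatio L v γH : ℂ) =
              (hilbertSymbol (v.adicCompletion ↥(maximalRealSubfield L)) (β : v.adicCompletion ↥(maximalRealSubfield L))
                  (algebraMap ↥(maximalRealSubfield L) _ ((cmQuadraticGenerator L : 𝓞 ↥(maximalRealSubfield L)) : ↥(maximalRealSubfield L))) : ℂ) *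
                (((Nat.card (𝓞 ↥(maximalRealSubfield L) ⧸ v.asIdeal) : ℂ) ^ m))⁻¹ := by
  obtain ⟨VT, hVT, hT⟩ := tokens_anyPlace_of_isLocalGRegular L v w hw
  obtain ⟨VD, hVD, hD⟩ := exists_nhds_one_forall_finTau_mul_finWeylRatio_eq_anyPlace L v w hw μ hμω H'
  refine ⟨VT ∩ VD, Filter.inter_mem hVT hVD, fun γH hγ hreg => ?_⟩
  obtain ⟨⟨m, hm⟩, β, hβ⟩ := hT γH hγ.1 hreg
  exact ⟨m, β, hm, hβ, fun t ht hκ => hD γH hγ.2 m hm β hβ t ht hκ⟩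

end Scalar

end Literature.NumberTheory.Rogawski1990

end
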